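import Mathlib.Analysis.SpecialFunctions.ImproperIntegrals
import Mathlib.Analysis.Calculus.ParametricIntegral
import Mathlib.MeasureTheory.Group.Integral
import Mathlib.Analysis.SpecialFunctions.Pow.Complex
import Mathlib.MeasureTheory.Integral.ExpDecay
import HarnessLib

/-!
# `ConeMagnification`: Laplace-transform lemmas for the continuation step (route `SignCone`, item
stmt-RiemannHypothesis-16303; HELPER file, `--supports`)

Generic analysis for the continuation theorem of the magnification chain (translate-boundedness ⟹
`D_c(s) M_G(s) - M_G(1)/(s-1)` holomorphic on `Re s > 1/2`): with the Laplace transform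
`𝓛u(z) = ∫₀^∞ u(x) e^{-zx} dx` written out as a Bochner integral over `Ioi 0`,

* `differentiableOn_laplace` — for `u` continuous and bounded on `[0, ∞)`, `𝓛u` is holomorphic on
  `Re z > 0` (differentiation under the integral sign);
* `integral_exp_half_laplace` — `𝓛(e^{x/2})(z) = 1/(z - 1/2)` on `Re z > 1/2` (the pole of the polar term);
* `laplace_shift_eq`, `laplace_shift_neg_eq_zero` — for a kernel `K` vanishing on `|v| ≥ R` and `a ≥ R`:
  `𝓛(K(a - ·))(z) = e^{-za} ∫ K(v) e^{zv} dv` and `𝓛(K(-a - ·)) = 0` (the node terms `K(± log n - x)` of a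
  translated fake prime sum become `n^{-z} · Ǩ(z)`);
* `integral_norm_shift_mul_exp_le` — `∫₀^∞ ‖K(±a - x)‖ e^{-σx} dx ≤ 2 R M e^{σ(R - a)}` (the summable
  majorant justifying the interchange of the node sum with the Laplace integral).
-/

noncomputable section

-- `Summit.RiemannHypothesis.RiemannHypothesis.…` repeats a namespace component by design (D-0017 layout).
set_option linter.dupNamespace false

open Complex Filter Set MeasureTheory Metric Topology

namespace Summit.RiemannHypothesis.RiemannHypothesis.Theorems.SignCone

/-! ## Holomorphy of Laplace transforms of bounded continuous functions -/

/-- `x ≤ (2/ε) e^{ε x/2}` for `ε > 0` (from `y + 1 ≤ e^y`). [folklore] -/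
theorem le_div_mul_exp_half {ε : ℝ} (hε : 0 < ε) (x : ℝ) :
    x ≤ 2 / ε * Real.exp (ε * x / 2) := by
  have h := Real.add_one_le_exp (ε * x / 2)
  have h2 : ε * x / 2 ≤ Real.exp (ε * x / 2) := by linarith
  rw [div_mul_eq_mul_div, le_div_iff₀ hε]
  nlinarith

/-- **Laplace transforms of bounded continuous functions are holomorphic on `Re z > 0`.** For
`u : ℝ → ℂ` continuous with `‖u(x)‖ ≤ C` on `x ≥ 0`, `z ↦ ∫₀^∞ u(x) e^{-zx} dx` is complex differentiable
at every `z` with `Re z > 0` (differentiation under the integral sign, dominated on the ball of radius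
`Re z₀/2` by `C x e^{-(Re z₀/2) x} ≤ (4C/Re z₀) e^{-(Re z₀/4) x}`). [folklore] -/
theorem differentiableOn_laplace {u : ℝ → ℂ} (hu : Continuous u) {C : ℝ}
    (hC : ∀ x : ℝ, 0 ≤ x → ‖u x‖ ≤ C) :
    DifferentiableOn ℂ (fun z : ℂ => ∫ x in Ioi (0 : ℝ), u x * cexp (-(z * x))) {z : ℂ | 0 < z.re} := by
  intro z₀ hz₀
  have hz₀' : 0 < z₀.re := hz₀
  have hC0 : 0 ≤ C := (norm_nonneg _).trans (hC 0 le_rfl)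
  set ε : ℝ := z₀.re / 2 with hε
  have hεp : 0 < ε := by positivity
  set μ : Measure ℝ := volume.restrict (Ioi (0 : ℝ)) with hμ
  set F : ℂ → ℝ → ℂ := fun z x => u x * cexp (-(z * x)) with hF
  set F' : ℂ → ℝ → ℂ := fun z x => u x * (-(x : ℂ) * cexp (-(z * x))) with hF'
  have hFc : ∀ z, Continuous (F z) := fun z => by simp only [hF]; fun_prop
  have hF'c : ∀ z, Continuous (F' z) := fun z => by simp only [hF']; fun_prop
  have hF_meas : ∀ᶠ z in 𝓝 z₀, AEStronglyMeasurable (F z) μ :=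
    Eventually.of_forall fun z => (hFc z).aestronglyMeasurable
  -- integrability of `F z₀` on `(0, ∞)`: dominated by `C e^{-Re z₀ x}`
  have hnormF : ∀ z : ℂ, ∀ x : ℝ, ‖F z x‖ = ‖u x‖ * Real.exp (-(z.re * x)) := by
    intro z x
    simp only [hF, norm_mul, Complex.norm_exp, neg_re, mul_re, ofReal_re, ofReal_im, mul_zero,
      sub_zero]
  have hF_int : Integrable (F z₀) μ := by
    have hi := (exp_neg_integrableOn_Ioi 0 hz₀').const_mul C
    simp only [neg_mul] at hi
    refine Integrable.mono' hi (hFc z₀).aestronglyMeasurable ?_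
    refine (ae_restrict_iff' measurableSet_Ioi).2 (Eventually.of_forall fun x hx => ?_)
    rw [hnormF]
    exact mul_le_mul_of_nonneg_right (hC x (le_of_lt hx)) (Real.exp_pos _).le
  have hF'_meas : AEStronglyMeasurable (F' z₀) μ := (hF'c z₀).aestronglyMeasurable
  -- the dominating function on the ball `‖z - z₀‖ < ε`
  set bound : ℝ → ℝ := fun x => C * (2 / ε * Real.exp (-(ε / 2 * x))) with hbound
  have h_bound : ∀ᵐ x ∂μ, ∀ z ∈ ball z₀ ε, ‖F' z x‖ ≤ bound x := by
    refine (ae_restrict_iff' measurableSet_Ioi).2 (Eventually.of_forall fun x hx z hz => ?_)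
    have hx0 : 0 ≤ x := le_of_lt hx
    have hzre : ε < z.re := by
      have h1 : |(z - z₀).re| ≤ ‖z - z₀‖ := abs_re_le_norm _
      have h2 : ‖z - z₀‖ < ε := by rwa [mem_ball, dist_eq_norm] at hz
      have h3 : (z - z₀).re = z.re - z₀.re := by simp
      rw [h3] at h1
      have := neg_abs_le (z.re - z₀.re)
      linarith
    have hn : ‖F' z x‖ = ‖u x‖ * (x * Real.exp (-(z.re * x))) := by
      simp only [hF', norm_mul, norm_neg, Complex.norm_real, Real.norm_eq_abs, abs_of_nonneg hx0,
        Complex.norm_exp, neg_re, mul_re, ofReal_re, ofReal_im, mul_zero, sub_zero]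
    rw [hn, hbound]
    refine mul_le_mul (hC x hx0) ?_ (by positivity) hC0
    have h1 : Real.exp (-(z.re * x)) ≤ Real.exp (-(ε * x)) :=
      Real.exp_le_exp.2 (by nlinarith)
    have h2 := le_div_mul_exp_half hεp x
    calc x * Real.exp (-(z.re * x)) ≤ (2 / ε * Real.exp (ε * x / 2)) * Real.exp (-(ε * x)) :=
          mul_le_mul h2 h1 (Real.exp_pos _).le (by positivity)
      _ = 2 / ε * Real.exp (-(ε / 2 * x)) := by
          rw [mul_assoc, ← Real.exp_add]
          congr 2
          ring
  have bound_integrable : Integrable bound μ := by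
    have hi := ((exp_neg_integrableOn_Ioi 0 (by positivity : 0 < ε / 2)).const_mul (2 / ε)).const_mul C
    simp only [neg_mul] at hi
    exact hi
  have h_diff : ∀ᵐ x ∂μ, ∀ z ∈ ball z₀ ε, HasDerivAt (F · x) (F' z x) z := by
    refine Eventually.of_forall fun x z _ => ?_
    simp only [hF, hF']
    have h1 : HasDerivAt (fun z : ℂ => -(z * x)) (-(x : ℂ)) z := by
      have h := hasDerivAt_mul_const (-(x : ℂ)) (x := z)
      have e : (fun y : ℂ => y * -(x : ℂ)) = fun y : ℂ => -(y * x) := by funext y; ring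
      rwa [e] at h
    exact (h1.cexp.const_mul (u x)).congr_deriv (by ring)
  have key := hasDerivAt_integral_of_dominated_loc_of_deriv_le (ball_mem_nhds z₀ hεp)
    hF_meas hF_int hF'_meas h_bound bound_integrable h_diff
  exact key.2.differentiableAt.differentiableWithinAt

/-! ## The Laplace transform of `e^{x/2}` -/

/-- `∫₀^∞ e^{x/2} e^{-zx} dx = 1/(z - 1/2)` for `Re z > 1/2`. [folklore] -/
theorem integral_exp_half_laplace {z : ℂ} (hz : 1 / 2 < z.re) :
    ∫ x in Ioi (0 : ℝ), cexp ((x : ℂ) / 2) * cexp (-(z * x)) = 1 / (z - 1 / 2) := by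
  have ha : ((1 / 2 : ℂ) - z).re < 0 := by
    simp only [sub_re, one_div]
    norm_num
    linarith
  have h := integral_exp_mul_complex_Ioi ha 0
  have e : (fun x : ℝ => cexp ((x : ℂ) / 2) * cexp (-(z * x))) = fun x : ℝ => cexp ((1 / 2 - z) * x) := by
    funext x
    rw [← Complex.exp_add]
    congr 1
    ring
  rw [e, h]
  simp only [ofReal_zero, mul_zero, Complex.exp_zero]
  rw [show (1 : ℂ) / 2 - z = -(z - 1 / 2) by ring, div_neg, neg_div, neg_neg]

/-! ## Shifted kernels: `K(a - x)` and `K(-a - x)` -/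

variable {K : ℝ → ℂ} {R : ℝ}

/-- For `K` vanishing on `|v| ≥ R` and `a ≥ R`, the function `x ↦ K(a - x)` vanishes on `x ≤ 0`, so its
Laplace transform is an integral over the whole line, and the substitution `v = a - x` gives
`∫₀^∞ K(a - x) e^{-zx} dx = e^{-za} ∫ K(v) e^{zv} dv`. [folklore] -/
theorem laplace_shift_eq (hK : ∀ v : ℝ, R ≤ |v| → K v = 0) (hR : 0 ≤ R) {a : ℝ} (ha : R ≤ a) (z : ℂ) :
    ∫ x in Ioi (0 : ℝ), K (a - x) * cexp (-(z * x)) = cexp (-(z * a)) * ∫ v : ℝ, K v * cexp (z * v) := by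
  have hzero : ∀ x : ℝ, x ∉ Ioi (0 : ℝ) → K (a - x) * cexp (-(z * x)) = 0 := by
    intro x hx
    rw [mem_Ioi, not_lt] at hx
    have : R ≤ |a - x| := by
      rw [abs_of_nonneg (by linarith)]
      linarith
    rw [hK _ this, zero_mul]
  rw [setIntegral_eq_integral_of_forall_compl_eq_zero hzero]
  have key := integral_sub_left_eq_self (fun v : ℝ => K v * cexp (z * v - z * a)) volume a
  have e : (fun x : ℝ => K (a - x) * cexp (z * ((a - x : ℝ) : ℂ) - z * a)) =
      fun x : ℝ => K (a - x) * cexp (-(z * x)) := by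
    funext x
    congr 2
    push_cast
    ring
  rw [e] at key
  rw [key, ← integral_const_mul]
  congr 1 with v
  rw [Complex.exp_sub, mul_div_assoc', mul_comm (cexp (-(z * a))), Complex.exp_neg]
  field_simp

/-- For `K` vanishing on `|v| ≥ R` and `a ≥ R`, `x ↦ K(-a - x)` vanishes on `x > 0`:
`∫₀^∞ K(-a - x) e^{-zx} dx = 0`. [folklore] -/
theorem laplace_shift_neg_eq_zero (hK : ∀ v : ℝ, R ≤ |v| → K v = 0) (hR : 0 ≤ R) {a : ℝ} (ha : R ≤ a)
    (z : ℂ) :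
    ∫ x in Ioi (0 : ℝ), K (-a - x) * cexp (-(z * x)) = 0 := by
  refine setIntegral_eq_zero_of_forall_eq_zero fun x hx => ?_
  have hx' : 0 < x := hx
  have : R ≤ |-a - x| := by
    rw [show -a - x = -(a + x) by ring, abs_neg, abs_of_nonneg (by linarith)]
    linarith
  rw [hK _ this, zero_mul]

/-! ## The summable majorant -/

/-- **Majorant for the shifted kernels.** If `K` vanishes on `|v| ≥ R` (`R ≥ 0`) and
`‖K‖ ≤ M`, then for `σ ≥ 0` and every real `b`,
`∫₀^∞ ‖K(b - x)‖ e^{-σx} dx ≤ 2 R M e^{σ(R - b)}`: the integrand lives on `x ∈ [b - R, b + R]`, where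
`e^{-σx} ≤ e^{-σ(b - R)}`. (Used with `b = log n`, giving `2RM e^{σR} n^{-σ}`, and with `b = -log n`.) [folklore] -/
theorem integral_norm_shift_mul_exp_le (hK : ∀ v : ℝ, R ≤ |v| → K v = 0)
    (hR : 0 ≤ R) {M : ℝ} (hM : ∀ v, ‖K v‖ ≤ M) {σ : ℝ} (hσ : 0 ≤ σ) (b : ℝ) :
    ∫ x in Ioi (0 : ℝ), ‖K (b - x)‖ * Real.exp (-(σ * x)) ≤ 2 * R * M * Real.exp (σ * (R - b)) := by
  have hM0 : 0 ≤ M := (norm_nonneg _).trans (hM 0)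
  set φ : ℝ → ℝ := fun x => ‖K (b - x)‖ * Real.exp (-(σ * x)) with hφ
  have hφ0 : ∀ x, 0 ≤ φ x := fun x => by positivity
  -- restrict to the window `[b - R, b + R]`
  set S : Set ℝ := Ioi (0 : ℝ) ∩ Icc (b - R) (b + R) with hS
  have hvan : ∀ x ∈ Ioi (0 : ℝ) \ S, φ x = 0 := by
    rintro x ⟨hx, hxS⟩
    have hx' : x ∉ Icc (b - R) (b + R) := fun h => hxS ⟨hx, h⟩
    simp only [mem_Icc, not_and_or, not_le] at hx'
    have : R ≤ |b - x| := by
      rcases hx' with h | h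
      · rw [abs_of_nonneg (by linarith)]; linarith
      · rw [abs_of_nonpos (by linarith)]; linarith
    simp only [hφ, hK _ this, norm_zero, zero_mul]
  have hSm : MeasurableSet S := measurableSet_Ioi.inter measurableSet_Icc
  have hsub : S ⊆ Ioi (0 : ℝ) := inter_subset_left
  have heq : ∫ x in Ioi (0 : ℝ), φ x = ∫ x in S, φ x :=
    setIntegral_eq_of_subset_of_forall_sdiff_eq_zero measurableSet_Ioi hsub hvan
  have hvol : volume S ≤ ENNReal.ofReal (2 * R) := by
    calc volume S ≤ volume (Icc (b - R) (b + R)) := measure_mono inter_subset_right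
      _ = ENNReal.ofReal (2 * R) := by rw [Real.volume_Icc]; congr 1; ring
  have hvol' : volume S < ⊤ := hvol.trans_lt ENNReal.ofReal_lt_top
  have hbd : ∀ x ∈ S, ‖φ x‖ ≤ M * Real.exp (σ * (R - b)) := by
    rintro x ⟨_, hx1, _⟩
    rw [Real.norm_of_nonneg (hφ0 x), hφ]
    refine mul_le_mul (hM _) (Real.exp_le_exp.2 (by nlinarith)) (Real.exp_pos _).le hM0
  have h := norm_setIntegral_le_of_norm_le_const hvol' hbd
  rw [Real.norm_of_nonneg (setIntegral_nonneg hSm fun x _ => hφ0 x)] at h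
  rw [heq]
  refine h.trans ?_
  have htr : (volume S).toReal ≤ 2 * R := by
    have := ENNReal.toReal_mono ENNReal.ofReal_ne_top hvol
    rwa [ENNReal.toReal_ofReal (by linarith)] at this
  calc M * Real.exp (σ * (R - b)) * (volume S).toReal
      ≤ M * Real.exp (σ * (R - b)) * (2 * R) := mul_le_mul_of_nonneg_left htr (by positivity)
    _ = 2 * R * M * Real.exp (σ * (R - b)) := by ring

end Summit.RiemannHypothesis.RiemannHypothesis.Theorems.SignCone

end
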